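import Summits.BirchSwinnertonDyer.Rank1Residual.GaloisImage.KolyvaginCoreTransport
import Summits.BirchSwinnertonDyer.Rank1Residual.GaloisImage.KolyvaginSystemsKummerVanish
import Summits.BirchSwinnertonDyer.Rank1Residual.GaloisImage.PrimeChoiceSakamotoDeep
import Summits.BirchSwinnertonDyer.Rank1Residual.GaloisImage.KolyvaginScalarTransport
import HarnessLib

/-!
# Route `KimAtThreeKolyvagin` (rung W2), crux `ShallowEqDeepAtTorsionFree` (item
# stmt-BirchSwinnertonDyer-19077): GOOD CORE VERTICES of bounded size above every level — the
# Selmer-vanishing half of the port shared by cruxes 19076/19077, at the residual level `m = 1`, in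
# cell n1011's Kolyvagin-system currency

Cell `bsd-addord`, seat `bsd-addord-w2-c4` (D-0074 row B7), gen 3.  TOOL theorems only (no definition,
no named fact, no `sorry`); nothing asserted about any particular curve; nothing booked; no mark moved.

## Why (the place of this file in the route)

On the `t = 0` Kato stratum the conclusion of crux 19077 follows from crux 19076's GRANTED the
dictionary port (kim3 `KimAtThreeKolyvaginDeepLowerKatoStratumShallow.shallowEqDeep_conclusion_of_ports_of_deepUpper`;
w2-c4 gen 0/2), and w2-c3 reduced 19076's Kato side to per-depth witness PRODUCERS plus two new ports,
one of which is the **GOOD CORE VERTEX per depth**: a level `d` of the depth-`K` Kolyvagin datum, of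
size bounded independently of `K`, at which `Λ ∘ loc₃` is injective on `H¹_{𝓕_can(d)}(ℚ, E[3^K])`
(hypothesis `hinj` of `KimAtThreeDeepUpperEndCore.EndCore.exists_certificate_of_witnessAt`) — i.e.
`H¹_{𝓚(d)}(ℚ, E[3^K]) = 0` for the classical (Kummer) structure — and the generator `g d` has full
order (hS24's bijectivity clause at `λ^*(d) = 0`).  In the reading of 19077 (w2-c4 gen 2 memo §2) this
is input (A) "φ-attainment ⟺ one Bloch–Kato-Selmer-killing cyclic level of FIXED size per depth".
Mazur–Rubin prove the existence of core vertices by Chebotarev (Prop. 3.6.1) and global duality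
(Cor. 4.1.9: "a path of length `λ(n, Ā^*)` to a core vertex"); this file types that argument at the
residual level `m = 1` (coefficients `𝔽_p`) for a Selmer structure of CORE RANK ZERO — the case of
the classical structure `𝓚` on `E[p]` (residually self-dual, Sakamoto §5.2) — with the SIZE BOUND
made explicit, and with the primes drawn from a DEEP Frobenius class (`ℓ ≡ 1 (mod p^m)`, `Frob_ℓ ~ τ`
on `E[p^m]`), which is what a depth-`m` datum needs.  Everything is assembled from cell n1011's
library (`GaloisImage/Kolyvagin*`, `PrimeChoiceSakamotoDeep`); the `χ = 1` twin is n1011's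
`CoreRankOne.exists_core_superset` (`KolyvaginCoreTransport.lean` §8), which §2 clones at `χ = 0`.

## What

* §1 `exists_natCard_dualSelmerGroup_eq_pow` — finite subgroups of `H¹(K, M^D)` have `p`-power order.
* §2 `natCard_selmerGroup_atLevel_eq_of_hasCoreRank_zero` (`#H(d) = #H^*(d)` at every level when
  `χ(𝓕) = 0`; Rubin Ex. 2.1.4), **`exists_superset_selmerGroup_eq_bot_of_hasCoreRank_zero`**: `K` any
  number field, `M` finite killed by `p`, `𝓕` unramified outside `S` with finite Selmer groups and
  `χ(𝓕) = 0`, `D` a Kolyvagin datum with Rubin's local shapes, prime choice `hprime` (Rubin Prop. 2.7.1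
  shape) ⟹ every level `n` lies in a level `d` with `H^*(d) = 0 = H(d)` and `p^{#d} ∣ p^{#n}·#H^*(n)`.
* §3 **`exists_superset_kummerSelmerGroup_eq_bot_of_deepClass`** / `exists_level_…`: the reading for
  `M = E[p]`, `𝓕 = 𝓚` (classical `p`-descent structure, `p` odd, `ρ̄_{E,p}` onto) and a datum whose
  primes are Sakamoto's class of `τ` on an AUXILIARY module `ρ′` with `ker ρ′ ≤ ker ρ̄` (`ρ′ = E[p^m]`):
  `χ(𝓚) = 0` by n1011's residual self-duality count, `hprime` by n1011's deep prime choice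
  (Sakamoto Cor. 5.5 / Mazur–Rubin Prop. 3.6.1, Chebotarev) through the inverse Weil transport;
  from the empty level the bound reads `p^{#d} ∣ #Sel^{(p)}(E/K)`.
The `ℚ`, `p = 3` instance on the `3`-adic tower's deep classes with the local shapes discharged, and
the `hinj` reading at every depth, are the sibling file `KimAtThreeShallowEqDeepGoodCoreVertexRat`.

## What is NOT here (honest status)

No crux is proved.  This is the RESIDUAL (`E[p]`) Selmer-vanishing; the depth-`K` statement
`H¹_{𝓚(d)}(ℚ, E[p^K]) = 0` needs the dévissage along `E[p] ↪ E[p^K]` (Mazur–Rubin Lemma 3.5.3 /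
Sakamoto's cartesian property Def. 3.5 for the Kummer and transverse conditions) — not in this file;
the full-order clause `hord` comes from [S24] Thm. 4.4 (1)'s bijectivity at `λ^*(d) = 0` (the named
fact `Sakamoto2024.kolyvaginSystems_freeRankOne_zmod_three_pow`), not here.

References: K. Rubin, *Euler systems and Kolyvagin systems*, PCMI 18 (2011), Ex. 2.1.4, Ex. 2.5.4,
Cor. 2.6.2, Prop. 2.7.1, Cor. 2.7.3 (pp. 18–24) [Rubin2011]; B. Mazur, K. Rubin, *Kolyvagin systems*,
Mem. AMS 799 (2004), Prop. 3.6.1, Def. 4.1.8, Cor. 4.1.9, Thm. 4.2.2 [MazurRubin2004]; R. Sakamoto,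
JTNB 36 (2024), Def. 3.6, Lemma 5.2, Cor. 5.5, §5.2 (pp. 923–930) [Sakamoto2024]; J. Silverman, *AEC*
(2009), Prop. III.8.1 [SilvermanAEC2009]; J. Milne, *ADT* (2006), I Thm. 2.8 [MilneADT2006].
-/

set_option autoImplicit false
-- the Theorems namespace of a single-conjunct summit repeats the summit name by design (D-0017)
set_option linter.dupNamespace false

noncomputable section

open scoped Classical NumberField ContRepresentation
open Function Field NumberField IsDedekindDomain
open Literature.NumberTheory.GaloisRepresentations Literature.NumberTheory.GaloisRepresentations.DiscreteGaloisModule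
  Literature.NumberTheory.GaloisCohomology
open Summit.BirchSwinnertonDyer.Rank1Residual.GaloisImage
open Summit.BirchSwinnertonDyer.Rank1Residual.GaloisImage.CoreRankZero
open Summit.BirchSwinnertonDyer.Rank1Residual.X11b.Levels

universe u

namespace Summit.BirchSwinnertonDyer.BirchSwinnertonDyer.Theorems.KimAtThreeShallowEqDeepGoodCoreVertex

/-! ## §1. `p`-power orders -/

section PGroup

variable {K : Type u} [Field K] [NumberField K]
variable {M : Type u} [AddCommGroup M] [TopologicalSpace M] [DiscreteTopology M] [Finite M]
variable {ρ : DiscreteGaloisModule K M} {p : ℕ} [Fact p.Prime]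

omit [NumberField K] in
/-- Every subgroup of `H¹(K, M^D)` (`M^D = Hom(M, μ_p)`, killed by `p`) that is finite has order a
power of `p`. [folklore] -/
theorem exists_natCard_dualSelmerGroup_eq_pow
    (H : AddSubgroup (galoisCohomology (ρ.tateDual p) 1)) [Finite H] :
    ∃ j : ℕ, Nat.card H = p ^ j := by
  refine Transport.exists_natCard_eq_pow_of_nsmul_eq_zero (p := p) (K := 1) fun x => ?_
  refine Subtype.ext ?_
  rw [AddSubgroupClass.coe_nsmul, pow_one, AddSubgroup.coe_zero]
  exact galoisCohomology.nsmul_eq_zero_of_forall (ρ.tateDual p)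
    (fun f => DiscreteGaloisModule.TateDual.nsmul_eq_zero f) _

end PGroup

/-! ## §2. Killing the Selmer group at core rank zero: levels of bounded size -/

section CoreRankZero

variable {K : Type u} [Field K] [NumberField K]
variable {M : Type u} [AddCommGroup M] [TopologicalSpace M] [DiscreteTopology M] [Finite M]
variable {ρ : DiscreteGaloisModule K M}

/-- **`#H¹_{𝓕(d)}(K, M) = #H¹_{𝓕(d)^*}(K, M^D)` at every level `d` when `χ(𝓕) = 0`**
(`HasCoreRank inv 𝓕 p 0`): the difference `λ(d) − λ^*(d)` is independent of `d`
(n1011 `card_selmerGroup_atLevel_mul`, Rubin Ex. 2.1.4) and is `0` at `d = 1`.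
[cite: Rubin2011, Exercise 2.1.4 (p. 18)] [cite: Sakamoto2024, Lemma 3.7 (1) (p. 923)] -/
theorem natCard_selmerGroup_atLevel_eq_of_hasCoreRank_zero {p : ℕ} [Fact p.Prime]
    {inv : LocalInvariants K p}
    (hperf : inv.IsPerfect) (hsum : inv.SumLocalTermEqZero) (hcompl : inv.SelmerComplement)
    (hM : ∀ m : M, p • m = 0) {S : Finset (Place K)}
    (hS : ∀ v : HeightOneSpectrum (𝓞 K), (Sum.inr v : Place K) ∉ S →
      ((p : ℕ) : 𝓞 K) ∉ v.asIdeal ∧ GaloisRep.IsUnramifiedAt v ρ)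
    {𝓕 : SelmerStructure ρ} (h𝓕 : 𝓕.IsUnramifiedOutside S)
    (hfin : Finite 𝓕.selmerGroup) (hfind : Finite (inv.dualSelmerStructure ρ 𝓕).selmerGroup)
    (hχ : LocalInvariants.HasCoreRank inv 𝓕 p 0)
    {D : KolyvaginDatum ρ} (hPS : ∀ q ∈ D.primes, (Sum.inr q : Place K) ∉ S)
    (hU : ∀ q ∈ D.primes, Nat.card (unramifiedSubgroup (GaloisRep.toLocal q ρ) 1) = p)
    (hT : ∀ q ∈ D.primes, Nat.card (D.transverse (Sum.inr q)) = p)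
    {d : Finset (HeightOneSpectrum (𝓞 K))} (hd : D.IsLevel d) :
    Nat.card (D.atLevel 𝓕 d).selmerGroup =
      Nat.card (inv.dualSelmerStructure ρ (D.atLevel 𝓕 d)).selmerGroup := by
  have hmul := card_selmerGroup_atLevel_mul hperf hsum hcompl hM hS h𝓕 hfin hfind hPS
    (fun q hq => by rw [hU q hq, hT q hq]) hd
  rw [LocalInvariants.HasCoreRank, pow_zero, one_mul] at hχ
  rw [hχ] at hmul
  have h0 : Nat.card (inv.dualSelmerStructure ρ 𝓕).selmerGroup ≠ 0 := Nat.card_pos.ne'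
  refine mul_right_cancel₀ h0 ?_
  rw [hmul, mul_comm]

/-- **Above every level there is a level of bounded size where both `H¹_{𝓕(d)}(K, M)` and
`H¹_{𝓕(d)^*}(K, M^D)` vanish**, when `χ(𝓕) = 0` (GOOD CORE VERTICES at core rank zero; Rubin
Cor. 2.7.3 / Mazur–Rubin Cor. 4.1.9 "there is a core vertex `n₀` and a path of length
`λ(n, Ā^*)` from `n` to `n₀`" read at `χ = 0`, where a core vertex has BOTH groups zero, Rubin
Ex. 2.5.4 (4)): while `H^*(n) ≠ 0` — whence `H(n) ≠ 0`, `#H(n) = #H^*(n)` — the prime choice on a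
non-zero class of each gives `𝔮 ∉ n` with `#H^*(n𝔮) < #H^*(n)` (n1011
`card_dualSelmerGroup_atLevel_insert_lt`, Rubin Cor. 2.6.2 (4)); the orders being powers of `p`,
at most `log_p #H^*(n)` primes are added: `p^{#d} ∣ p^{#n} · #H^*(n)`.  The prime choice `hprime`
is Rubin's Prop. 2.7.1 shape (a class and a dual class, a prime of `𝒫` outside the level), exactly
as in n1011's `CoreRankOne.exists_core_superset` (the `χ = 1` twin, which this clones).
[cite: Rubin2011, Cor. 2.6.2 (4), Prop. 2.7.1, Cor. 2.7.3 (pp. 22–24)]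
[cite: MazurRubin2004, Cor. 4.1.9] -/
theorem exists_superset_selmerGroup_eq_bot_of_hasCoreRank_zero {p : ℕ} [Fact p.Prime]
    {inv : LocalInvariants K p}
    (hperf : inv.IsPerfect) (hsum : inv.SumLocalTermEqZero) (hcompl : inv.SelmerComplement)
    (hM : ∀ m : M, p • m = 0) {S : Finset (Place K)}
    (hS : ∀ v : HeightOneSpectrum (𝓞 K), (Sum.inr v : Place K) ∉ S →
      ((p : ℕ) : 𝓞 K) ∉ v.asIdeal ∧ GaloisRep.IsUnramifiedAt v ρ)
    {𝓕 : SelmerStructure ρ} (h𝓕 : 𝓕.IsUnramifiedOutside S)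
    (hfin : Finite 𝓕.selmerGroup) (hfind : Finite (inv.dualSelmerStructure ρ 𝓕).selmerGroup)
    (hχ : LocalInvariants.HasCoreRank inv 𝓕 p 0)
    {D : KolyvaginDatum ρ} (hPS : ∀ q ∈ D.primes, (Sum.inr q : Place K) ∉ S)
    (hU : ∀ q ∈ D.primes, Nat.card (unramifiedSubgroup (GaloisRep.toLocal q ρ) 1) = p)
    (hT : ∀ q ∈ D.primes, Nat.card (D.transverse (Sum.inr q)) = p)
    (hUT : ∀ q ∈ D.primes,
      unramifiedSubgroup (GaloisRep.toLocal q ρ) 1 ⊔ D.transverse (Sum.inr q) = ⊤)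
    (hprime : ∀ d, D.IsLevel d → ∀ c ∈ (D.atLevel 𝓕 d).selmerGroup,
      ∀ c' ∈ (inv.dualSelmerStructure ρ (D.atLevel 𝓕 d)).selmerGroup, c ≠ 0 → c' ≠ 0 →
        ∃ q ∈ D.primes, q ∉ d ∧ galoisCohomology.localization ρ (Sum.inr q) 1 c ≠ 0 ∧
          galoisCohomology.localization (ρ.tateDual p) (Sum.inr q) 1 c' ≠ 0)
    {n : Finset (HeightOneSpectrum (𝓞 K))} (hn : D.IsLevel n) :
    ∃ d, n ⊆ d ∧ D.IsLevel d ∧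
      (inv.dualSelmerStructure ρ (D.atLevel 𝓕 d)).selmerGroup = ⊥ ∧
      (D.atLevel 𝓕 d).selmerGroup = ⊥ ∧
      p ^ d.card ∣ p ^ n.card * Nat.card (inv.dualSelmerStructure ρ (D.atLevel 𝓕 n)).selmerGroup := by
  have hp : p.Prime := Fact.out
  -- at any level: `H^*(d) = ⊥ → H(d) = ⊥` (equal orders)
  have hboth : ∀ d, D.IsLevel d → (inv.dualSelmerStructure ρ (D.atLevel 𝓕 d)).selmerGroup = ⊥ →
      (D.atLevel 𝓕 d).selmerGroup = ⊥ := by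
    intro d hd hbot
    haveI := finite_selmerGroup_atLevel D 𝓕 hfin d
    have hc := natCard_selmerGroup_atLevel_eq_of_hasCoreRank_zero hperf hsum hcompl hM hS h𝓕 hfin hfind
      hχ hPS hU hT hd
    rw [hbot, AddSubgroup.card_bot] at hc
    exact AddSubgroup.eq_bot_of_card_eq (D.atLevel 𝓕 d).selmerGroup hc
  suffices h : ∀ (N : ℕ) (n : Finset (HeightOneSpectrum (𝓞 K))), D.IsLevel n →
      Nat.card (inv.dualSelmerStructure ρ (D.atLevel 𝓕 n)).selmerGroup = N →
        ∃ d, n ⊆ d ∧ D.IsLevel d ∧ (inv.dualSelmerStructure ρ (D.atLevel 𝓕 d)).selmerGroup = ⊥ ∧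
          p ^ d.card ∣ p ^ n.card * N by
    obtain ⟨d, hnd, hd, hbot, hdiv⟩ := h _ n hn rfl
    exact ⟨d, hnd, hd, hbot, hboth d hd hbot, hdiv⟩
  intro N
  induction N using Nat.strong_induction_on with
  | _ N ih =>
    intro n hn hN
    haveI hfn := finite_dualSelmerGroup_atLevel inv D 𝓕 hfind n
    by_cases hbot : (inv.dualSelmerStructure ρ (D.atLevel 𝓕 n)).selmerGroup = ⊥
    · refine ⟨n, subset_rfl, hn, hbot, ?_⟩
      rw [← hN]
      exact Dvd.intro _ rfl
    · haveI := finite_selmerGroup_atLevel D 𝓕 hfin n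
      obtain ⟨y, hy, hy0⟩ := (AddSubgroup.bot_or_exists_ne_zero _).resolve_left hbot
      -- `H(n) ≠ 0` since `#H(n) = #H^*(n) ≠ 1`
      have hne : (D.atLevel 𝓕 n).selmerGroup ≠ ⊥ := by
        intro h
        have hc := natCard_selmerGroup_atLevel_eq_of_hasCoreRank_zero hperf hsum hcompl hM hS h𝓕 hfin
          hfind hχ hPS hU hT hn
        rw [h, AddSubgroup.card_bot] at hc
        exact hbot (AddSubgroup.eq_bot_of_card_eq _ hc.symm)
      obtain ⟨x, hx, hx0⟩ := (AddSubgroup.bot_or_exists_ne_zero _).resolve_left hne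
      obtain ⟨q, hq, hqn, hxq, hyq⟩ := hprime n hn x hx y hy hx0 hy0
      have hlt := card_dualSelmerGroup_atLevel_insert_lt hperf hsum hcompl hM hS h𝓕 hfin hfind hPS hU
        hUT n hq hqn hx hxq hy hyq
      obtain ⟨d, hnd, hd, hdcore, hdiv⟩ := ih _ (hN ▸ hlt) (insert q n) (hn.insert hq) rfl
      refine ⟨d, (Finset.subset_insert q n).trans hnd, hd, hdcore, ?_⟩
      -- orders are powers of `p`: `#H^*(n𝔮) < #H^*(n)` gives `p · #H^*(n𝔮) ∣ #H^*(n)`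
      haveI := finite_dualSelmerGroup_atLevel inv D 𝓕 hfind (insert q n)
      obtain ⟨a, ha⟩ := exists_natCard_dualSelmerGroup_eq_pow (p := p)
        (inv.dualSelmerStructure ρ (D.atLevel 𝓕 (insert q n))).selmerGroup
      obtain ⟨b, hb⟩ := exists_natCard_dualSelmerGroup_eq_pow (p := p)
        (inv.dualSelmerStructure ρ (D.atLevel 𝓕 n)).selmerGroup
      rw [ha, hb] at hlt
      have hab : a + 1 ≤ b := (Nat.pow_lt_pow_iff_right hp.one_lt).1 hlt
      rw [Finset.card_insert_of_notMem hqn, ha] at hdiv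
      rw [← hN, hb]
      calc p ^ d.card ∣ p ^ (n.card + 1) * p ^ a := hdiv
        _ = p ^ n.card * p ^ (a + 1) := by ring
        _ ∣ p ^ n.card * p ^ b := mul_dvd_mul_left _ (pow_dvd_pow p hab)

end CoreRankZero

/-! ## §3. The reading for `E[p]` and the classical Selmer structure on a DEEP Frobenius class -/

section Torsion

-- universe `0`: the tree's Chebotarev (`frobenius_dense`) behind the prime choice quantifies `K : Type`
variable {K : Type} [Field K] [NumberField K]

open WeierstrassCurve Literature.NumberTheory.EllipticCurves
open Summit.BirchSwinnertonDyer.Rank1Residual.X11b.LocBridge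

/-- **Good core vertices of bounded size for `(E[p], 𝓚, 𝒫)` on a DEEP Frobenius class.**  `E/K` an
elliptic curve over a number field, `p` odd, `ρ̄_{E,p}` onto; `𝓚 = kummerSelmerStructure p` the
classical `p`-descent structure on `E[p]` (`H¹_𝓚(K, E[p]) = Sel^{(p)}(E/K)`, assumed finite); `D` a
Kolyvagin datum on `E[p]` with Rubin's local shapes at its primes, whose primes are Sakamoto's class
`frobeniusClassPrimes ρ′ S′ τ N′` read through an AUXILIARY module `ρ′` with `ker ρ′ ≤ ker ρ̄_{E,p}`
(for the depth-`m` datum of the route: `ρ′ = E[p^m]`, `N′ = p^m` — the primes `ℓ ≡ 1 (mod p^m)` with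
`Frob_ℓ` in the class of `τ` on `E[p^m]`), `E[p]/(τ − 1) ≃ ℤ/p`, and (H.3) on `G_{F′}`.  THEN above
every level `n` there is a level `d ⊇ n` with `H¹_{𝓚(d)}(K, E[p]) = 0 = H¹_{𝓚(d)^*}(K, E[p]^D)` and
`p^{#d} ∣ p^{#n} · #H¹_{𝓚(n)^*}(K, E[p]^D)`.  Assembly: `χ(𝓚) = 0` by the residual self-duality count
(n1011 `natCard_selmerGroup_kummer_eq_dual`: Weil pairing + Tate's local Euler characteristic `hEP`),
the prime choice on the deep class (n1011
`PrimeChoice.infinite_setOf_mem_frobeniusClassPrimes_localization_ne_zero_three_deep`, Sakamoto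
Cor. 5.5 / Mazur–Rubin Prop. 3.6.1 by Chebotarev) turned into Rubin's mixed shape through the
inverse Weil transport (`CoreRankOne.hprime_of_localization_pair_infinite`), and §2.
[cite: Rubin2011, Cor. 2.6.2 (4), Prop. 2.7.1, Cor. 2.7.3 (pp. 22–24)] [cite: MazurRubin2004, Prop. 3.6.1, Cor. 4.1.9]
[cite: Sakamoto2024, Lemma 5.2 and Cor. 5.5 (pp. 928–929)] [cite: SilvermanAEC2009, Prop. III.8.1] -/
theorem exists_superset_kummerSelmerGroup_eq_bot_of_deepClass (W : WeierstrassCurve K) [W.IsElliptic]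
    (p : ℕ) [Fact p.Prime] (hp2 : p ≠ 2) [Finite (geomTorsion W (p : ℤ))]
    (hsurj : W.HasSurjectiveModNGaloisRep (p : ℤ))
    {inv : LocalInvariants K p}
    (hperf : inv.IsPerfect) (hsum : inv.SumLocalTermEqZero) (hcompl : inv.SelmerComplement)
    (hEP : ∀ v : HeightOneSpectrum (𝓞 K), localEulerPoincareCharacteristic (v.adicCompletion K))
    {S : Finset (Place K)}
    (hS : ∀ v : HeightOneSpectrum (𝓞 K), (Sum.inr v : Place K) ∉ S →
      ((p : ℕ) : 𝓞 K) ∉ v.asIdeal ∧ GaloisRep.IsUnramifiedAt v (W.torsionGaloisModule (p : ℤ)))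
    (h𝓚 : (W.kummerSelmerStructure (p : ℤ)).IsUnramifiedOutside S)
    [hfin : Finite (W.kummerSelmerStructure (p : ℤ)).selmerGroup]
    {D : KolyvaginDatum (W.torsionGaloisModule (p : ℤ))}
    (hPS : ∀ q ∈ D.primes, (Sum.inr q : Place K) ∉ S)
    (hU : ∀ q ∈ D.primes,
      Nat.card (unramifiedSubgroup (GaloisRep.toLocal q (W.torsionGaloisModule (p : ℤ))) 1) = p)
    (hT : ∀ q ∈ D.primes, Nat.card (D.transverse (Sum.inr q)) = p)
    (hUT : ∀ q ∈ D.primes,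
      unramifiedSubgroup (GaloisRep.toLocal q (W.torsionGaloisModule (p : ℤ))) 1 ⊔
        D.transverse (Sum.inr q) = ⊤)
    -- the DEEP Frobenius class carrying the datum's primes
    {M' : Type} [AddCommGroup M'] [TopologicalSpace M'] [DiscreteTopology M'] [Finite M']
    (ρ' : DiscreteGaloisModule K M')
    (hker : ∀ u : absoluteGaloisGroup K, ρ' u = 1 → (W.torsionGaloisModule (p : ℤ)) u = 1)
    {S' : Set (HeightOneSpectrum (𝓞 K))} (hS' : S'.Finite) {τ : absoluteGaloisGroup K} {N' : ℕ}
    (hN' : N' ≠ 0) (hP : D.primes = frobeniusClassPrimes ρ' S' τ N')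
    (hτ : Nonempty (cokerSubOne (W.torsionGaloisModule (p : ℤ)) τ ≃+ ZMod p))
    (hH3 : ∀ f : contOneCocycles (W.torsionGaloisModule (p : ℤ)).toTopRep,
      (∀ u : absoluteGaloisGroup K, ρ' u = 1 → u ∈ rootsOfUnityFixer K N' → f.1 u = 0) →
        oneCocycleClass (W.torsionGaloisModule (p : ℤ)).toTopRep f = 0)
    {n : Finset (HeightOneSpectrum (𝓞 K))} (hn : D.IsLevel n) :
    ∃ d, n ⊆ d ∧ D.IsLevel d ∧
      (inv.dualSelmerStructure (W.torsionGaloisModule (p : ℤ))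
        (D.atLevel (W.kummerSelmerStructure (p : ℤ)) d)).selmerGroup = ⊥ ∧
      (D.atLevel (W.kummerSelmerStructure (p : ℤ)) d).selmerGroup = ⊥ ∧
      p ^ d.card ∣ p ^ n.card * Nat.card (inv.dualSelmerStructure (W.torsionGaloisModule (p : ℤ))
        (D.atLevel (W.kummerSelmerStructure (p : ℤ)) n)).selmerGroup := by
  have hp : p.Prime := Fact.out
  haveI : NeZero p := ⟨hp.ne_zero⟩
  have hp3 : 3 ≤ p := by
    rcases hp.eq_two_or_odd' with h | h
    · exact absurd h hp2
    · have := hp.two_le; omega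
  obtain ⟨e, hμ, hadd₁, hadd₂, halt, hnondeg, hgal⟩ :=
    exists_weilPairing_holds W p hp.two_le (Nat.cast_ne_zero.2 hp.ne_zero)
  have hinv : ∀ v : HeightOneSpectrum (𝓞 K), Injective (inv (Sum.inr v)) := fun v => (hperf v).1.1
  have hM : ∀ m : geomTorsion W (p : ℤ), p • m = 0 := fun T => AddSubgroup.torsionBy.nsmul T
  -- `χ(𝓚) = 0`: the residual self-duality count
  have hcount := natCard_selmerGroup_kummer_eq_dual W p e hμ hadd₁ hadd₂ hgal halt hnondeg hp.isPrimePow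
    (hp.odd_of_ne_two hp2) inv hinv hEP
  have hχ : LocalInvariants.HasCoreRank inv (W.kummerSelmerStructure (p : ℤ)) p 0 := by
    rw [LocalInvariants.HasCoreRank, pow_zero, one_mul]
    exact hcount
  have hfind : Finite (inv.dualSelmerStructure (W.torsionGaloisModule (p : ℤ))
      (W.kummerSelmerStructure (p : ℤ))).selmerGroup := by
    apply Nat.finite_of_card_ne_zero
    rw [← hcount]
    exact Nat.card_pos.ne'
  -- the prime choice on the deep class (two classes of `H¹(K, E[p])`), in Rubin's mixed shape
  have hirr := hasIrreducibleModPGaloisRep_of_hasSurjectiveModNGaloisRep W p hsurj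
  have hC55 := PrimeChoice.infinite_setOf_mem_frobeniusClassPrimes_localization_ne_zero_three_deep
    (W.torsionGaloisModule (p : ℤ)) ρ' hker hp3 hN' S' hS' hτ
    (fun A hA => hirr A fun σ P hP' => hA σ P hP') hH3
  have hch : ∀ c₁ c₂ : galoisCohomology (W.torsionGaloisModule (p : ℤ)) 1, c₁ ≠ 0 → c₂ ≠ 0 →
      {q ∈ D.primes | galoisCohomology.localization (W.torsionGaloisModule (p : ℤ)) (Sum.inr q) 1 c₁ ≠ 0 ∧
        galoisCohomology.localization (W.torsionGaloisModule (p : ℤ)) (Sum.inr q) 1 c₂ ≠ 0}.Infinite := by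
    intro c₁ c₂ h₁ h₂
    rw [hP]
    exact (hC55 c₁ c₂ c₂ h₁ h₂ h₂).mono fun q hq => ⟨hq.1, hq.2.1, hq.2.2.1⟩
  have hprime := CoreRankOne.hprime_of_localization_pair_infinite
    (weilDualIntertwining W p e hμ hadd₁ hadd₂ hgal) (weilDualInv W p e hμ hadd₁ hadd₂ hgal hnondeg)
    (weilDualIntertwining_weilDualInv W p e hμ hadd₁ hadd₂ hgal hnondeg)
    (𝓕 := W.kummerSelmerStructure (p : ℤ)) (inv := inv) (D := D) hch
  exact exists_superset_selmerGroup_eq_bot_of_hasCoreRank_zero hperf hsum hcompl hM hS h𝓚 hfin hfind hχ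
    hPS hU hT hUT hprime hn

/-- **The same from the empty level, with the bound read on the `p`-Selmer group**: a level `d`
of the datum with `H¹_{𝓚(d)}(K, E[p]) = 0 = H¹_{𝓚(d)^*}(K, E[p]^D)` and `p^{#d} ∣ #Sel^{(p)}(E/K)` —
at most `dim_{𝔽_p} Sel^{(p)}(E/K)` Kolyvagin primes of the deep class kill the classical Selmer group
(`#H¹_{𝓚^*} = #H¹_𝓚` by the residual self-duality count).
[cite: Rubin2011, Cor. 2.7.3 (p. 24)] [cite: MazurRubin2004, Prop. 3.6.1, Cor. 4.1.9]
[cite: Sakamoto2024, Cor. 5.5 (p. 929)] -/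
theorem exists_level_kummerSelmerGroup_eq_bot_of_deepClass (W : WeierstrassCurve K) [W.IsElliptic]
    (p : ℕ) [Fact p.Prime] (hp2 : p ≠ 2) [Finite (geomTorsion W (p : ℤ))]
    (hsurj : W.HasSurjectiveModNGaloisRep (p : ℤ))
    {inv : LocalInvariants K p}
    (hperf : inv.IsPerfect) (hsum : inv.SumLocalTermEqZero) (hcompl : inv.SelmerComplement)
    (hEP : ∀ v : HeightOneSpectrum (𝓞 K), localEulerPoincareCharacteristic (v.adicCompletion K))
    {S : Finset (Place K)}
    (hS : ∀ v : HeightOneSpectrum (𝓞 K), (Sum.inr v : Place K) ∉ S →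
      ((p : ℕ) : 𝓞 K) ∉ v.asIdeal ∧ GaloisRep.IsUnramifiedAt v (W.torsionGaloisModule (p : ℤ)))
    (h𝓚 : (W.kummerSelmerStructure (p : ℤ)).IsUnramifiedOutside S)
    [hfin : Finite (W.kummerSelmerStructure (p : ℤ)).selmerGroup]
    {D : KolyvaginDatum (W.torsionGaloisModule (p : ℤ))}
    (hPS : ∀ q ∈ D.primes, (Sum.inr q : Place K) ∉ S)
    (hU : ∀ q ∈ D.primes,
      Nat.card (unramifiedSubgroup (GaloisRep.toLocal q (W.torsionGaloisModule (p : ℤ))) 1) = p)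
    (hT : ∀ q ∈ D.primes, Nat.card (D.transverse (Sum.inr q)) = p)
    (hUT : ∀ q ∈ D.primes,
      unramifiedSubgroup (GaloisRep.toLocal q (W.torsionGaloisModule (p : ℤ))) 1 ⊔
        D.transverse (Sum.inr q) = ⊤)
    {M' : Type} [AddCommGroup M'] [TopologicalSpace M'] [DiscreteTopology M'] [Finite M']
    (ρ' : DiscreteGaloisModule K M')
    (hker : ∀ u : absoluteGaloisGroup K, ρ' u = 1 → (W.torsionGaloisModule (p : ℤ)) u = 1)
    {S' : Set (HeightOneSpectrum (𝓞 K))} (hS' : S'.Finite) {τ : absoluteGaloisGroup K} {N' : ℕ}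
    (hN' : N' ≠ 0) (hP : D.primes = frobeniusClassPrimes ρ' S' τ N')
    (hτ : Nonempty (cokerSubOne (W.torsionGaloisModule (p : ℤ)) τ ≃+ ZMod p))
    (hH3 : ∀ f : contOneCocycles (W.torsionGaloisModule (p : ℤ)).toTopRep,
      (∀ u : absoluteGaloisGroup K, ρ' u = 1 → u ∈ rootsOfUnityFixer K N' → f.1 u = 0) →
        oneCocycleClass (W.torsionGaloisModule (p : ℤ)).toTopRep f = 0) :
    ∃ d, D.IsLevel d ∧
      (inv.dualSelmerStructure (W.torsionGaloisModule (p : ℤ))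
        (D.atLevel (W.kummerSelmerStructure (p : ℤ)) d)).selmerGroup = ⊥ ∧
      (D.atLevel (W.kummerSelmerStructure (p : ℤ)) d).selmerGroup = ⊥ ∧
      p ^ d.card ∣ Nat.card (W.kummerSelmerStructure (p : ℤ)).selmerGroup := by
  have hp : p.Prime := Fact.out
  haveI : NeZero p := ⟨hp.ne_zero⟩
  obtain ⟨d, -, hd, hbot, hbot', hdiv⟩ := exists_superset_kummerSelmerGroup_eq_bot_of_deepClass W p hp2
    hsurj hperf hsum hcompl hEP hS h𝓚 hPS hU hT hUT ρ' hker hS' hN' hP hτ hH3 D.isLevel_empty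
  refine ⟨d, hd, hbot, hbot', ?_⟩
  obtain ⟨e, hμ, hadd₁, hadd₂, halt, hnondeg, hgal⟩ :=
    exists_weilPairing_holds W p hp.two_le (Nat.cast_ne_zero.2 hp.ne_zero)
  have hinv : ∀ v : HeightOneSpectrum (𝓞 K), Injective (inv (Sum.inr v)) := fun v => (hperf v).1.1
  have hcount := natCard_selmerGroup_kummer_eq_dual W p e hμ hadd₁ hadd₂ hgal halt hnondeg hp.isPrimePow
    (hp.odd_of_ne_two hp2) inv hinv hEP
  have h0 : D.atLevel (W.kummerSelmerStructure (p : ℤ)) ∅ = W.kummerSelmerStructure (p : ℤ) :=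
    SelmerStructure.modify_empty _ D.transverse
  rw [Finset.card_empty, pow_zero, one_mul, h0, ← hcount] at hdiv
  exact hdiv

end Torsion

end Summit.BirchSwinnertonDyer.BirchSwinnertonDyer.Theorems.KimAtThreeShallowEqDeepGoodCoreVertex

end
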